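import Summits.CriticalPhenomena.CardyFormulaZ2.Theorems.CardyIKTransportIKLinearTransportStubCoalescingRowKernelCuts

/-!
# Stub `stub_CoalescingRowKernel` (A_dyn') — part F: a cut row FORCES the three middle colours

Support file (`--supports stmt-CriticalPhenomena-5076`, registered sub-goal `isCut_forces_mid`), first
ingredient of the remaining cut-Markov property (K) of `…Reduction.lean`: if `c` is a cut row of the pinned
statistic of a configuration `x` (`IsCut i c (pinnedStat i x)`, read from the environment alone), then IN `x`
the middle cells `(i+1, c-1), (i+1, c), (i+1, c+1)` carry the colour opposite to the boundary colour of the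
cut. Proof: the diagram pair `((i, c-2), (i, c+2))` is witnessed by a monochromatic strip path of the
opposite colour; rows change by at most one along the triangulation (`crk_adj_near`), so the path visits
each of the rows `c-1, c, c+1` (`SDE.exists_row_eq`), where the only strip cells of that colour are the middle
ones. Consequently the faces of the face rows `c-1, c` join cells of different colours whatever their flags —
the two facts behind the factorisation of the strip diagram across a cut row.
-/

noncomputable section

namespace Summit.CriticalPhenomena.CardyFormulaZ2.Theorems.IKLinearTransport.PinnedDiagramExchange

open scoped Classical MeasureTheory ENNReal symmDiff
open Set MeasureTheory
open Literature.Probability.Percolation Literature.Probability.LatticeModels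

/-- A monochromatic strip path between boundary cells of rows `≤ y ≤` visits a cell of row `y` of its colour
inside the strip. [folklore] -/
theorem crk_stripDiagram_visits_row (i : ℤ) (x : Obs) {P Q : Site 2} (h : (P, Q) ∈ stripDiagram i x) (y : ℤ)
    (h1 : P 1 ≤ y) (h2 : y ≤ Q 1) :
    ∃ w : Site 2, (w ∈ x.1 ↔ P ∈ x.1) ∧ i ≤ w 0 ∧ w 0 ≤ i + 2 ∧ w 1 = y := by
  obtain ⟨-, -, hQ, hP, hreach⟩ := h
  set s : Set (Site 2) := {v | (v ∈ x.1 ↔ P ∈ x.1) ∧ i ≤ v 0 ∧ v 0 ≤ i + 2} with hs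
  have hG : ∀ u v : s, ((cellGraph x.2).induce s).Adj u v → (v : Site 2) 1 ≤ (u : Site 2) 1 + 1 := by
    intro u v huv
    exact (crk_adj_near (SimpleGraph.comap_adj.1 huv)).1
  obtain ⟨w, -, hw⟩ := SDE.exists_row_eq ((cellGraph x.2).induce s) (fun v : s => (v : Site 2) 1) hG hreach y h1 h2
  exact ⟨w, w.2.1, w.2.2.1, w.2.2.2, hw⟩

/-- A CUT ROW FORCES THE THREE MIDDLE COLOURS (registered sub-goal `isCut_forces_mid`): if `c` is a cut row
of the pinned statistic of `x`, the middle cells of the rows `c-1, c, c+1` carry, in `x`, the colour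
opposite to the boundary colour `[(i, c) ∈ x.1]` of the cut. [folklore] -/
theorem isCut_forces_mid : ∀ (i c : ℤ) (x : Obs), IsCut i c (pinnedStat i x) →
    ∀ y : ℤ, c - 1 ≤ y → y ≤ c + 1 → ((![i + 1, y] : Site 2) ∈ x.1 ↔ (![i, c] : Site 2) ∉ x.1) := by
  intro i c x h y hy1 hy2
  have hi : (i : ℤ) ≠ i + 1 := by omega
  have hi2 : (i + 2 : ℤ) ≠ i + 1 := by omega
  obtain ⟨hbd, hm2, -, -, hpair⟩ := h
  simp only [pinnedStat, crk_mem_eraseMid_fst i x _ _ hi, crk_mem_eraseMid_fst i x _ _ hi2] at hbd hm2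
  have hpair' : ((![i, c - 2], ![i, c + 2]) : Site 2 × Site 2) ∈ stripDiagram i x := hpair
  obtain ⟨w, hwcol, hw0, hw0', hw1⟩ := crk_stripDiagram_visits_row i x hpair' y (by simp; omega) (by simp; omega)
  have hw_eq : w = ![w 0, w 1] := (SDE.site2_eta w).symm
  -- the visited cell of row `y` has the colour of `(i, c-2)`, opposite to the boundary colour
  have hwc : w ∈ x.1 ↔ (![i, c] : Site 2) ∉ x.1 := hwcol.trans hm2
  by_cases h0 : w 0 = i + 1
  · rw [hw_eq, h0, hw1] at hwc; exact hwc
  · exfalso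
    rcases (show w 0 = i ∨ w 0 = i + 2 by omega) with h0' | h0'
    · have hb := (hbd y hy1 hy2).1
      rw [hw_eq, h0', hw1] at hwc
      exact iff_not_self (hb.symm.trans hwc)
    · have hb := (hbd y hy1 hy2).2
      rw [hw_eq, h0', hw1] at hwc
      exact iff_not_self (hb.symm.trans hwc)

/-- Under a cut row the four faces of the face rows `c-1, c` at the face columns `i, i+1` are BICHROMATIC:
both diagonals of each join cells of different colours, so their flags do not affect any monochromatic
path. Stated for the corner pairs of the two diagonals of the faces `(i, y)` and `(i+1, y)`, `y ∈ {c-1, c}`.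
[folklore] -/
theorem isCut_faces_bichromatic (i c : ℤ) (x : Obs) (h : IsCut i c (pinnedStat i x)) (y : ℤ)
    (hy1 : c - 1 ≤ y) (hy2 : y ≤ c) :
    ¬ ((![i, y] : Site 2) ∈ x.1 ↔ (![i + 1, y + 1] : Site 2) ∈ x.1) ∧
    ¬ ((![i, y + 1] : Site 2) ∈ x.1 ↔ (![i + 1, y] : Site 2) ∈ x.1) ∧
    ¬ ((![i + 1, y] : Site 2) ∈ x.1 ↔ (![i + 2, y + 1] : Site 2) ∈ x.1) ∧
    ¬ ((![i + 1, y + 1] : Site 2) ∈ x.1 ↔ (![i + 2, y] : Site 2) ∈ x.1) := by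
  have hmid := isCut_forces_mid i c x h
  have hi : (i : ℤ) ≠ i + 1 := by omega
  have hi2 : (i + 2 : ℤ) ≠ i + 1 := by omega
  obtain ⟨hbd, -, -, -, -⟩ := h
  simp only [pinnedStat, crk_mem_eraseMid_fst i x _ _ hi, crk_mem_eraseMid_fst i x _ _ hi2] at hbd
  have hL0 := (hbd y hy1 (by omega)).1
  have hL1 := (hbd (y + 1) (by omega) (by omega)).1
  have hR0 := (hbd y hy1 (by omega)).2
  have hR1 := (hbd (y + 1) (by omega) (by omega)).2
  have hM0 := hmid y hy1 (by omega)
  have hM1 := hmid (y + 1) (by omega) (by omega)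
  refine ⟨fun h' => ?_, fun h' => ?_, fun h' => ?_, fun h' => ?_⟩
  · exact iff_not_self ((hL0.symm.trans h').trans hM1)
  · exact iff_not_self ((hL1.symm.trans h').trans hM0)
  · exact iff_not_self ((hR1.symm.trans h'.symm).trans hM0)
  · exact iff_not_self ((hR0.symm.trans h'.symm).trans hM1)

end Summit.CriticalPhenomena.CardyFormulaZ2.Theorems.IKLinearTransport.PinnedDiagramExchange
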